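import Summits.ResolutionOfSingularities.KangarooAtlas.MizutaniRationalPoint
import Summits.ResolutionOfSingularities.KangarooAtlas.MizutaniLowerBound
import Summits.ResolutionOfSingularities.KangarooAtlas.MizutaniNumber
import HarnessLib

/-!
# Every `k^{1/q}`-rational point has a Hironaka scheme of exponent `≤ e` (Oda 1983-II Cor. 2.3, «⇐», for points)

Cell `pub-rosobs`, Mizutani enclosure (seat mizutani-encloser-1, gen 8).  AI-written; *AI review is weaker than
expert review*; NOT a resolution-of-singularities theorem (summit relevance C).

T. Oda (Publ. RIMS 19 (1983), Cor. 2.3, p. 1171) characterises the exponent of a Hironaka subgroup scheme `B`: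
«`exponent(B) ≤ e` iff the corresponding `V` is defined over `F^{−e}(k)`»; in Thm. 3.1 (p. 1173) the scheme `B(𝔭)`
of a point is `Φ^{(1)}(L_0, φ)` for the evaluation `φ` of linear forms at the point, «of exponent `≤ e` iff `φ` can
be taken over `F^{−e}(k)`».  H. Mizutani (Nagoya Math. J. 52 (1973), (*) of §1 and Prop. 2.5) works accordingly
with pairs `(V, W)`, `W` a `k^q`-vector space, `q = p^e`: these are H-schemes of exponent `e`, and `e(H*) = e(H)`.
In the tree's vocabulary (`invForms`, `ExponentLE`, Oda's printed description taken as DEFINITION) the points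
«defined over `F^{−e}(k)`» are the `k^{1/q}`-RATIONAL POINTS `ratPoint k p e c = [c_0^{1/q} : ⋯ : c_n^{1/q}]`
(`MizutaniRationalPoint.lean`).  This file proves the «⇐» direction for them:

* **`exponentLE_ratPoint : ExponentLE k p (ratPoint k p e c) e`** — for EVERY field `k` of characteristic `p`,
  every `e`, `n` and every vector `c ∈ k^{n+1}`; `exponent_ratPoint_le : exponent k p (ratPoint k p e c) ≤ e`.
  (So far the tree had this only for the attained point `attP` (`MizutaniAttainedForms`) and, with exponent `0`,
  for `k^p`-independent `c` with `n + 1 < 2p` (`MizutaniExamplesInseparable`).)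

The mechanism is the tensor-level form of the in-house note's §3 (d) («`N` defined over `k″` ⟹ `N ⊂ I^{(e−1)}`»):

* **`IsRootTower.sum_tmul_pow_mem_frobPowerIdeal_pow`** — in a root tower `K = L(x^{1/q})` (`q = p^e`,
  `[K : L] = q^s`), a tensor `Σ_i y_i ⊗ z_i^p ∈ K ⊗_L K` with `p`-th-POWER RIGHT FACTORS that lies in `J^q`
  lies in `I_S = (J^{[p]})^{q/p}`: under `Ω̃ : K ⊗_L K ≅ K[δ]/(δ^q)` the factor `1 ⊗ z^p` becomes a polynomial in
  `δ_1^p, …, δ_s^p`, `J^q` becomes «all monomials of degree `≥ q`», and a monomial `δ^{pM}` of degree `≥ q` has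
  `floor(pM) = |M| ≥ q/p` (`omegaTilde_mem_map_of_floorSum`);
* **`sum_tmul_pow_mem_frobIdeal_pow`** — the same in `k ⊗_{k^{p^{e+1}}} k` for an arbitrary field, through a
  finite `p`-independent envelope (`exists_finset_realised_pow`, `exists_pIndep_adjoin`, `isRootTower_adjoin`);
* at `𝔭 = ratPoint k p e c` the coordinate vectors of `ξ_i^{p^{e+m+1}}` are multiples of `(c_i^{p^{m+1}})_i`
  (`exists_coord_ratPoint_eq_mul`), so `rho j a = (1 ⊗ ν_j) · Σ_i a_i ⊗ (c_i^{p^m})^p`; with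
  `mem_invForms_ratPoint_iff` and the HEART `mem_span_frobVec_of_rho_mem_split` (`MizutaniInvFormsSplit`):
  **`invForms_ratPoint_succ_eq`** `(L_B)_{e+m+1} = k·F (L_B)_{e+m}` for every `m`, whence `exponentLE_ratPoint`.

Corollaries: `exponent_ratPoint_eq_of_ne` (the exponent is EXACTLY `e` as soon as `(L_B)_e ≠ k·F(L_B)_{e−1}`)
and `exponent_ratPoint_eq_one` (`e = 1`: `k^p`-independent coordinates and a nonzero invariant form of level one);
the application to the dual point of an extremal point of Mizutani's Thm. 2.8 (Prop. 2.5's «`e(H*) = e(H)`») is in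
`MizutaniExtremalExponent.lean`.

## References

* T. Oda, *Hironaka's additive group scheme, II*, Publ. RIMS Kyoto Univ. 19 (1983) 1163–1179, Cor. 2.3 (p. 1171),
  Thm. 3.1 (p. 1173). [Oda1983HironakaGroupSchemeII]
* H. Mizutani, *Hironaka's additive group schemes*, Nagoya Math. J. 52 (1973) 85–95, §1 (*), Lemma 2.4, Prop. 2.5,
  Lemma 2.7, Thm. 2.8. [Mizutani1973HironakaGroupSchemes]
-/

noncomputable section

open MvPolynomial TensorProduct Literature.AlgebraicGeometry.Resolution
  Literature.AlgebraicGeometry.Resolution.HironakaScheme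

namespace Summit.ResolutionOfSingularities.KangarooAtlas.Mizutani

universe u

/-! ## `p`-th powers of polynomials in characteristic `p` only involve exponents divisible by `p` -/

section CharPSupport

variable {σ : Type*} {R : Type*} [CommSemiring R] (p : ℕ) [hp : Fact p.Prime] [CharP R p]

/-- In characteristic `p`, `f^p = Σ_M c_M^p X^{pM}`: every exponent of every monomial of `f^p` is divisible by `p`.
[folklore] -/
theorem dvd_of_mem_support_pow_char (f : MvPolynomial σ R) {M : σ →₀ ℕ} (hM : M ∈ (f ^ p).support) (i : σ) :
    p ∣ M i := by
  classical
  have hfp : f ^ p = ∑ N ∈ f.support, monomial (p • N) (coeff N f ^ p) := by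
    conv_lhs => rw [f.as_sum]
    rw [sum_pow_char]
    exact Finset.sum_congr rfl fun N _ => monomial_pow
  rw [hfp] at hM
  obtain ⟨N, -, hN⟩ := Finset.mem_biUnion.mp (support_sum hM)
  have hMN : M = p • N := Finset.mem_singleton.mp (support_monomial_subset hN)
  rw [hMN, Finsupp.smul_apply, smul_eq_mul]
  exact Dvd.intro _ rfl

end CharPSupport

/-! ## The split lemma in a root tower: `p`-th-power right factors and `J^q` force `I_S` -/

section PDivPoly

variable {K : Type*} [Field K] {s : ℕ} (p : ℕ)

/-- «Every exponent of every monomial is divisible by `p`» is stable under truncation to the box (the support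
only shrinks). [folklore] -/
theorem pdiv_trunc {f : MvPolynomial (Fin s) K} (hf : ∀ M ∈ f.support, ∀ i, p ∣ M i) (q : ℕ) :
    ∀ M ∈ (trunc q f).support, ∀ i, p ∣ M i := by
  intro M hM i
  refine hf M ?_ i
  rw [mem_support_iff] at hM ⊢
  rw [coeff_trunc] at hM
  split_ifs at hM with h
  · exact hM
  · exact absurd rfl hM

/-- … stable under multiplication by a constant. [folklore] -/
theorem pdiv_C_mul {f : MvPolynomial (Fin s) K} (hf : ∀ M ∈ f.support, ∀ i, p ∣ M i) (c : K) :
    ∀ M ∈ (C c * f).support, ∀ i, p ∣ M i := by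
  intro M hM i
  rw [C_mul'] at hM
  exact hf M (support_smul hM) i

/-- … stable under finite sums. [folklore] -/
theorem pdiv_sum {ι : Type*} (t : Finset ι) {g : ι → MvPolynomial (Fin s) K}
    (hg : ∀ j ∈ t, ∀ M ∈ (g j).support, ∀ i, p ∣ M i) :
    ∀ M ∈ (∑ j ∈ t, g j).support, ∀ i, p ∣ M i := by
  classical
  intro M hM i
  obtain ⟨j, hj, hjM⟩ := Finset.mem_biUnion.mp (support_sum hM)
  exact hg j hj M hjM i

/-- For a monomial with all exponents divisible by `p`, `degree = p · floor`. [folklore] -/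
theorem degree_eq_mul_floorSum {M : Fin s →₀ ℕ} (hM : ∀ i, p ∣ M i) : M.degree = p * floorSum p M := by
  rw [Finsupp.degree_eq_sum, floorSum_eq_sum, Finset.mul_sum]
  exact Finset.sum_congr rfl fun i _ => (Nat.mul_div_cancel' (hM i)).symm

end PDivPoly

section Tower

variable {L K : Type*} [Field L] [Field K] [Algebra L K] {s p e : ℕ} [hp : Fact p.Prime] [CharP K p]
  {x : Fin s → L} {a : Fin s → K}

/-- **The box coordinates of `Σ_i y_i ⊗ z_i^p` only involve monomials `δ^{pM}`**: under `Ω` the factor `1 ⊗ z^p`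
becomes `(z(a + δ))^p`, a `p`-th power in characteristic `p`. [cite: Oda1983HironakaGroupSchemeII, §1 (p. 1166: R = k ⊗_L k ≅ k[t]/(t^q))] -/
theorem IsRootTower.dvd_of_mem_support_Omega_sum_tmul_pow (h : IsRootTower L K (p ^ e) x a) {ι : Type*}
    (t : Finset ι) (y z : ι → K) :
    ∀ M ∈ (h.Omega (∑ i ∈ t, y i ⊗ₜ[L] (z i ^ p))).support, ∀ i, p ∣ M i := by
  rw [map_sum]
  refine pdiv_sum p t fun i _ => ?_
  rw [h.Omega_tmul, map_pow]
  have htau : truncQ (Fin s) K (p ^ e) (h.tau (z i) ^ p) =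
      Summit.ResolutionOfSingularities.KangarooAtlas.Mizutani.trunc (p ^ e)
        ((truncQ (Fin s) K (p ^ e) (h.tau (z i))) ^ p) := by
    conv_lhs => rw [← mk_truncQ (h.tau (z i)), ← map_pow, truncQ_mk]
  rw [htau]
  exact pdiv_C_mul p (pdiv_trunc p (fun M hM i => dvd_of_mem_support_pow_char p _ hM i) _) _

/-- **THE SPLIT LEMMA in a root tower** (MIZUTANI-PROOF-g59 §3 (d) «`N` defined over `k″` ⟹ `N ⊂ I^{(e−1)}`» at
tensor level): for `K = L(x^{1/q})`, `q = p^e`, `[K : L] = q^s`, a tensor `Σ_i y_i ⊗ z_i^p` with `p`-th-power right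
factors lying in `J^q` lies in `I_S = (J^{[p]})^{p^{e−1}}` — its box coordinates are supported on monomials `δ^{pM}`
of degree `≥ q`, whose floor is `|M| ≥ q/p`.
[cite: Oda1983HironakaGroupSchemeII, Cor. 2.3 (p. 1171: "exponent(B) ≤ e iff V is defined over F^{-e}(k)")] -/
theorem IsRootTower.sum_tmul_pow_mem_frobPowerIdeal_pow (h : IsRootTower L K (p ^ e) x a)
    (hdim : Module.finrank L K = (p ^ e) ^ s) {ι : Type*} (t : Finset ι) (y z : ι → K)
    (hJ : (∑ i ∈ t, y i ⊗ₜ[L] (z i ^ p)) ∈ KaehlerDifferential.ideal L K ^ p ^ e) :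
    (∑ i ∈ t, y i ⊗ₜ[L] (z i ^ p)) ∈ frobPowerIdeal L (K := K) p ^ p ^ (e - 1) := by
  set ω := ∑ i ∈ t, y i ⊗ₜ[L] (z i ^ p) with hω
  have hdiv := h.dvd_of_mem_support_Omega_sum_tmul_pow t y z
  have hfloor : ∀ M ∈ (h.Omega ω).support, p ^ (e - 1) ≤ floorSum p M := by
    intro M hM
    have hdeg := h.degree_le_of_mem_pow hJ M hM
    rcases Nat.eq_zero_or_pos e with rfl | he
    · -- `q = 1`: the box is `{0}`, but `degree ≥ 1` — vacuous
      exfalso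
      have hbox := h.Omega_box ω M hM
      have hM0 : M.degree = 0 := by
        rw [Finsupp.degree_eq_sum]
        exact Finset.sum_eq_zero fun i _ => by have := hbox i; rw [pow_zero] at this; omega
      rw [hM0, pow_zero] at hdeg
      exact Nat.not_succ_le_zero 0 hdeg
    · rw [degree_eq_mul_floorSum p (hdiv M hM)] at hdeg
      have hpe : p ^ e = p * p ^ (e - 1) := by rw [← pow_succ', Nat.sub_add_cancel he]
      rw [hpe] at hdeg
      exact Nat.le_of_mul_le_mul_left hdeg hp.out.pos
  have hmem := h.omegaTilde_mem_map_of_floorSum hfloor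
  have hcomap : ω ∈ ((frobPowerIdeal L p ^ p ^ (e - 1)).map h.omegaTilde).comap h.omegaTilde := hmem
  rw [Ideal.comap_map_of_surjective _ (h.omegaTilde_bijective hdim).2] at hcomap
  have hker : Ideal.comap h.omegaTilde ⊥ = ⊥ := by
    rw [← RingHom.ker_eq_comap_bot]
    exact (RingHom.injective_iff_ker_eq_bot _).mp (h.omegaTilde_bijective hdim).1
  rw [hker, sup_bot_eq] at hcomap
  exact hcomap

end Tower

/-! ## The split lemma over an arbitrary field: finite `p`-independent envelopes -/

section BigRing

variable (k : Type u) [Field k] (p : ℕ) [hp : Fact p.Prime] [CharP k p]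

/-- **THE SPLIT LEMMA in `k ⊗_{k^{p^{N+1}}} k`** (every field `k` of characteristic `p`): a tensor `Σ_i y_i ⊗ z_i^p`
with `p`-th-power right factors lying in `J^{p^{N+1}}` lies in `I_S = (J^{[p]})^{p^N}` — MIZUTANI-PROOF-g59 §3 (d)
at tensor level, through a finite `p`-independent envelope `k^{p^{N+1}}(b)` (`exists_finset_realised_pow`,
`exists_pIndep_adjoin`) and the root-tower case `IsRootTower.sum_tmul_pow_mem_frobPowerIdeal_pow`.
[cite: Oda1983HironakaGroupSchemeII, Cor. 2.3 (p. 1171: "exponent(B) ≤ e iff V is defined over F^{-e}(k)"); Mizutani1973HironakaGroupSchemes, Lemma 2.4] -/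
theorem sum_tmul_pow_mem_frobIdeal_pow (N : ℕ) {ι : Type*} [Fintype ι] (y z : ι → k)
    (hJ : (∑ i, y i ⊗ₜ[frobPow k p (N + 1)] (z i ^ p)) ∈
      KaehlerDifferential.ideal (frobPow k p (N + 1)) k ^ p ^ (N + 1)) :
    (∑ i, y i ⊗ₜ[frobPow k p (N + 1)] (z i ^ p)) ∈ frobIdeal k p (frobPow k p (N + 1)) ^ p ^ N := by
  classical
  set ω := ∑ i, y i ⊗ₜ[frobPow k p (N + 1)] (z i ^ p) with hω
  -- finite witnesses and a finite `p`-independent envelope containing them and the `y_i`, `z_i`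
  obtain ⟨Y, hY⟩ := exists_finset_realised_pow (K := frobPow k p (N + 1)) (p ^ (N + 1)) hJ
  set Y' : Finset k := Y ∪ Finset.univ.image y ∪ Finset.univ.image z with hY'
  obtain ⟨s, b, hb1, hY'F⟩ := exists_pIndep_adjoin (p := p) (N + 1) Y'
  have hbe : PIndep p (N + 1) b := hb1.of_one _ (Nat.le_add_left 1 N)
  set F := towerField (N + 1) b with hF
  have hYF : (↑Y : Set k) ⊆ (F : Set k) :=
    Set.Subset.trans (Finset.coe_subset.mpr
      ((Finset.subset_union_left).trans (Finset.subset_union_left))) hY'F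
  have hyF : ∀ i, y i ∈ F := fun i => hY'F (by
    rw [hY', Finset.coe_union, Finset.coe_union]
    exact Or.inl (Or.inr (by simp)))
  have hzF : ∀ i, z i ∈ F := fun i => hY'F (by
    rw [hY', Finset.coe_union]
    exact Or.inr (by simp))
  obtain ⟨ω₂, hω₂J, hω₂eq⟩ := ((realised_iff (frobPow k p (N + 1))).mp hY) F hYF
  -- the explicit preimage of `ω` in `F ⊗ F`
  set ω₂' : F ⊗[(frobPow k p (N + 1))] F :=
    ∑ i, (⟨y i, hyF i⟩ : F) ⊗ₜ[(frobPow k p (N + 1))] ((⟨z i, hzF i⟩ : F) ^ p) with hω₂'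
  have hmap : tensorIncl (frobPow k p (N + 1)) F ω₂' = ω := by
    rw [hω, hω₂', map_sum]
    refine Finset.sum_congr rfl fun i _ => ?_
    rw [Algebra.TensorProduct.map_tmul, map_pow]
    rfl
  have hω₂eq' : ω₂ = ω₂' := tensorIncl_injective (frobPow k p (N + 1)) F (hω₂eq.trans hmap.symm)
  have hJ' : ω₂' ∈ KaehlerDifferential.ideal (frobPow k p (N + 1)) F ^ p ^ (N + 1) := hω₂eq' ▸ hω₂J
  -- the root-tower case
  have hI' := (isRootTower_adjoin hbe).sum_tmul_pow_mem_frobPowerIdeal_pow (finrank_adjoin_eq hbe)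
    Finset.univ _ _ hJ'
  rw [Nat.add_sub_cancel] at hI'
  rw [← hmap]
  exact map_frobPowerIdeal_pow_le (frobPow k p (N + 1)) F (p ^ N) (Ideal.mem_map_of_mem _ hI')

end BigRing

/-! ## The exponent of a `k^{1/q}`-rational point -/

section RatPoint

variable (k : Type u) [Field k] (p e : ℕ) [hp : Fact p.Prime] [CharP k p] {n : ℕ} (c : Fin (n + 1) → k)

omit hp [CharP k p] in
/-- Linear algebra: if every vector orthogonal to `u` is orthogonal to `w`, then `w` is a multiple of `u`.
[folklore] -/
theorem exists_eq_mul_of_forall_sum_eq_zero (u w : Fin (n + 1) → k)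
    (h : ∀ g : Fin (n + 1) → k, ∑ i, g i * u i = 0 → ∑ i, g i * w i = 0) :
    ∃ ν : k, ∀ i, w i = ν * u i := by
  classical
  have hsingle : ∀ (v : Fin (n + 1) → k) (i : Fin (n + 1)) (t : k),
      ∑ l, Pi.single (M := fun _ => k) i t l * v l = t * v i := by
    intro v i t
    rw [Finset.sum_eq_single i (fun l _ hl => by rw [Pi.single_eq_of_ne hl, zero_mul])
      (fun hi => absurd (Finset.mem_univ i) hi), Pi.single_eq_same]
  by_cases hu : u = 0
  · refine ⟨0, fun i => ?_⟩
    have := h (Pi.single i 1) (by rw [hsingle, hu, Pi.zero_apply, mul_zero])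
    rw [hsingle, one_mul] at this
    rw [this, zero_mul]
  · obtain ⟨i₀, hi₀⟩ : ∃ i₀, u i₀ ≠ 0 := by
      by_contra hcon
      push Not at hcon
      exact hu (funext hcon)
    refine ⟨w i₀ / u i₀, fun i => ?_⟩
    have key := h (Pi.single i (u i₀) - Pi.single i₀ (u i)) (by
      simp only [Pi.sub_apply, sub_mul, Finset.sum_sub_distrib, hsingle]
      ring)
    simp only [Pi.sub_apply, sub_mul, Finset.sum_sub_distrib, hsingle] at key
    field_simp
    linear_combination key

/-- **At a `k^{1/q}`-rational point the coordinate vectors are multiples of `(c_i^{p^m})_i`**: for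
`𝔭 = ratPoint k p e c` and every basis vector `m_j` of `span_k{ξ_i^{p^{e+m}}} ⊂ S/𝔭`, `c_{ij} = ν_j c_i^{p^m}`
(an additive form of level `e + m` lies in `𝔭` iff `Σ g_i c_i^{p^m} = 0`, `addForm_mem_ratPoint_iff`).
[cite: Oda1983HironakaGroupSchemeII, Thm. 3.1 (p. 1173: φ over F^{-e}(k))] -/
theorem exists_coord_ratPoint_eq_mul (m : ℕ) (j : Fin (cdim k p (ratPoint k p e c) (e + m))) :
    ∃ ν : k, ∀ i, coord k p (ratPoint k p e c) (e + m) i j = ν * c i ^ p ^ m := by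
  refine exists_eq_mul_of_forall_sum_eq_zero k (fun i => c i ^ p ^ m)
    (fun i => coord k p (ratPoint k p e c) (e + m) i j) fun g hg => ?_
  have hmem : addForm k p (e + m) g ∈ ratPoint k p e c := (addForm_mem_ratPoint_iff (e := e) (c := c) m g).mpr hg
  exact (addForm_mem_iff k p (ratPoint k p e c) (e + m) g).mp hmem j

/-- **`rho j a = (1 ⊗ ν_j) · Σ_i a_i ⊗ c_i^{p^m}`** at `𝔭 = ratPoint k p e c`, level `e + m`.
[cite: Oda1983HironakaGroupSchemeII, Thm. 3.1 (p. 1173: (1 ⊗ φ)(v))] -/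
theorem exists_rho_ratPoint_eq (m : ℕ) (j : Fin (cdim k p (ratPoint k p e c) (e + m))) (a : Fin (n + 1) → k) :
    ∃ ν : k, rho k p (ratPoint k p e c) (e + m) j a =
      ((1 : k) ⊗ₜ[frobPow k p (e + m)] ν) * ∑ i, a i ⊗ₜ[frobPow k p (e + m)] (c i ^ p ^ m) := by
  obtain ⟨ν, hν⟩ := exists_coord_ratPoint_eq_mul k p e c m j
  refine ⟨ν, ?_⟩
  rw [rho_apply, Finset.mul_sum]
  refine Finset.sum_congr rfl fun i _ => ?_
  rw [hν, Algebra.TensorProduct.tmul_mul_tmul, one_mul]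

/-- **`(L_B)_{e+m+1} ⊆ k·F (L_B)_{e+m}` at a `k^{1/q}`-rational point**: every invariant form of level `e + m + 1`
of `ratPoint k p e c` is a `k`-combination of `p`-th powers of forms of level `e + m` — the tensors `rho j a` are
SPLIT (`sum_tmul_pow_mem_frobIdeal_pow`: their right factors `c_i^{p^{m+1}} = (c_i^{p^m})^p` are `p`-th powers),
so the HEART `mem_span_frobVec_of_rho_mem_split` applies.
[cite: Oda1983HironakaGroupSchemeII, Cor. 2.3 (p. 1171) and Thm. 3.1 (p. 1173: "of exponent ≤ e iff φ can be taken over F^{-e}(k)")] -/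
theorem invForms_ratPoint_succ_le (m : ℕ) :
    invForms k p (ratPoint k p e c) (e + m + 1) ≤
      Submodule.span k (frobVec k p 1 '' (invForms k p (ratPoint k p e c) (e + m) : Set (Fin (n + 1) → k))) := by
  intro a ha
  refine mem_span_frobVec_of_rho_mem_split k p (ratPoint k p e c) ratPoint_isPrime (e + m) a fun j => ?_
  obtain ⟨ν, hν⟩ := exists_rho_ratPoint_eq k p e c (m + 1) j a
  -- Oda's definition through duality: `Σ a_i ⊗ c_i^{p^{m+1}} ∈ J^{p^{e+m+1}}`
  have hβ : (∑ i, a i ⊗ₜ[frobPow k p (e + m + 1)] (c i ^ p ^ (m + 1))) ∈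
      KaehlerDifferential.ideal (frobPow k p (e + m + 1)) k ^ p ^ (e + m + 1) :=
    (mem_invForms_ratPoint_iff (e := e) (c := c) (m + 1) a).mp ha
  have hpow : (∑ i, a i ⊗ₜ[frobPow k p (e + m + 1)] (c i ^ p ^ (m + 1))) =
      ∑ i, a i ⊗ₜ[frobPow k p (e + m + 1)] ((c i ^ p ^ m) ^ p) :=
    Finset.sum_congr rfl fun i _ => by rw [← pow_mul, ← pow_succ]
  rw [hpow] at hβ
  have hsplit := sum_tmul_pow_mem_frobIdeal_pow k p (e + m) a (fun i => c i ^ p ^ m) hβ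
  rw [← hpow] at hsplit
  have hν' : rho k p (ratPoint k p e c) (e + m + 1) j a =
      ((1 : k) ⊗ₜ[frobPow k p (e + m + 1)] ν) * ∑ i, a i ⊗ₜ[frobPow k p (e + m + 1)] (c i ^ p ^ (m + 1)) := hν
  rw [hν']
  exact Ideal.mul_mem_left _ _ hsplit

/-- **`(L_B)_{e+m+1} = k·F (L_B)_{e+m}` at a `k^{1/q}`-rational point** (the reverse inclusion is `F`-stability).
[cite: Oda1983HironakaGroupSchemeII, Cor. 2.3 (p. 1171)] -/
theorem invForms_ratPoint_succ_eq (m : ℕ) :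
    invForms k p (ratPoint k p e c) (e + m + 1) =
      Submodule.span k (frobVec k p 1 '' (invForms k p (ratPoint k p e c) (e + m) : Set (Fin (n + 1) → k))) :=
  le_antisymm (invForms_ratPoint_succ_le k p e c m) (span_frobVec_image_le k p _ ratPoint_ne_top (e + m))

/-- `(L_B)_{e+m} = k·F^m (L_B)_e` at a `k^{1/q}`-rational point. [cite: Oda1983HironakaGroupSchemeII, Cor. 2.3 (p. 1171)] -/
theorem invForms_ratPoint_eq_span (m : ℕ) :
    invForms k p (ratPoint k p e c) (e + m) =
      Submodule.span k (frobVec k p m '' (invForms k p (ratPoint k p e c) e : Set (Fin (n + 1) → k))) := by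
  induction m with
  | zero =>
    have hid : frobVec k p 0 '' (invForms k p (ratPoint k p e c) e : Set (Fin (n + 1) → k)) =
        invForms k p (ratPoint k p e c) e := by
      have : frobVec k p 0 = (id : (Fin (n + 1) → k) → (Fin (n + 1) → k)) := funext (frobVec_zero k p)
      rw [this, Set.image_id]
    rw [hid, Submodule.span_eq]
    rfl
  | succ m ih =>
    show invForms k p (ratPoint k p e c) (e + m + 1) = _
    rw [invForms_ratPoint_succ_eq, ih, span_image_frobVec_span, Set.image_image]
    congr 1
    exact Set.image_congr' fun v => frobVec_frobVec (k := k) (p := p) 1 m v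

/-- **EVERY `k^{1/q}`-RATIONAL POINT HAS EXPONENT `≤ e`** (`q = p^e`): `ExponentLE k p (ratPoint k p e c) e` for every
field `k` of characteristic `p`, every `e`, `n` and every `c ∈ k^{n+1}` — Oda 1983-II Cor. 2.3 «`exponent(B) ≤ e` iff
`V` is defined over `F^{−e}(k)`» / Thm. 3.1 «iff `φ` can be taken over `F^{−e}(k)`», direction «⇐», for the points of
`ℙ^n_k` (Mizutani 1973 (*) of §1: the pairs `(V, W)` with `W` a `k^q`-space give the H-schemes of exponent `e`).
AI-written; *AI review is weaker than expert review*; not a resolution theorem.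
[cite: Oda1983HironakaGroupSchemeII, Cor. 2.3 (p. 1171) and Thm. 3.1 (p. 1173); Mizutani1973HironakaGroupSchemes, §1 (*) and Prop. 2.5] -/
theorem exponentLE_ratPoint : ExponentLE k p (ratPoint k p e c) e := by
  intro j hj
  obtain ⟨m, rfl⟩ := Nat.exists_eq_add_of_le hj
  rw [Nat.add_sub_cancel_left]
  exact invForms_ratPoint_eq_span k p e c m

/-- **`exponent B([c^{1/q}]) ≤ e`.** [cite: Oda1983HironakaGroupSchemeII, Cor. 2.3 (p. 1171); Mizutani1973HironakaGroupSchemes, Prop. 2.5] -/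
theorem exponent_ratPoint_le : exponent k p (ratPoint k p e c) ≤ e :=
  (exponent_le_iff k p _).mpr (exponentLE_ratPoint k p e c)

/-- **The exponent of `[c^{1/p^{e+1}}]` is EXACTLY `e + 1` as soon as `(L_B)_{e+1} ≠ k·F (L_B)_e`** (a new invariant
form at the top level). [cite: Oda1983HironakaGroupSchemeII, Cor. 2.3 (p. 1171); Mizutani1973HironakaGroupSchemes, §1 (c)] -/
theorem exponent_ratPoint_eq_of_ne (c : Fin (n + 1) → k)
    (hne : invForms k p (ratPoint k p (e + 1) c) (e + 1) ≠
      Submodule.span k (frobVec k p 1 '' (invForms k p (ratPoint k p (e + 1) c) e : Set (Fin (n + 1) → k)))) :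
    exponent k p (ratPoint k p (e + 1) c) = e + 1 := by
  refine le_antisymm (exponent_ratPoint_le k p (e + 1) c) ((le_exponent_iff k p _).mpr fun e' he' hE => hne ?_)
  have hE' : ExponentLE k p (ratPoint k p (e + 1) c) e := hE.mono (by omega)
  rw [hE' (e + 1) (Nat.le_succ e), Nat.add_sub_cancel_left]

/-- **`e = 1`: a point `[c^{1/p}]` with `k^p`-independent coordinates and a nonzero invariant form of level one has
exponent exactly `1`** — for instance the DUAL point `[a^{1/p}]` of an extremal point of `ℙ^{2p−1}` (`extremal_of_card_eq`):
Mizutani's «`e(H*) = e(H)`» (Prop. 2.5) for the extremal configuration of Thm. 2.8.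
[cite: Mizutani1973HironakaGroupSchemes, Prop. 2.5 ("Evidently we have e(H) = e(H*) and H** = H") and Thm. 2.8 Step (I)] -/
theorem exponent_ratPoint_eq_one {c : Fin (n + 1) → k} (hc : LinearIndependent (frobPow k p 1) c)
    (h1 : invForms k p (ratPoint k p 1 c) 1 ≠ ⊥) : exponent k p (ratPoint k p 1 c) = 1 := by
  refine exponent_ratPoint_eq_of_ne k p 0 c ?_
  rw [invForms_ratPoint_zero_eq_bot hc]
  have h0 : frobVec k p 1 '' ((⊥ : Submodule k (Fin (n + 1) → k)) : Set (Fin (n + 1) → k)) = {0} := by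
    rw [Submodule.bot_coe, Set.image_singleton]
    congr 1
    funext i
    rw [frobVec_one_apply, Pi.zero_apply, zero_pow hp.out.ne_zero]
  rw [h0, Submodule.span_zero_singleton]
  exact h1

end RatPoint

end Summit.ResolutionOfSingularities.KangarooAtlas.Mizutani

end
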